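import Mathlib.Analysis.Calculus.Deriv.Inv
import Literature.Probability.RandomPlanarGeometry.ConformalMap
import HarnessLib

/-!
# Real Möbius self-maps of the upper half-plane

Topic `Literature/Probability/RandomPlanarGeometry`. The real Möbius maps
`z ↦ (a z + b)/(c z + d)`, `a, b, c, d ∈ ℝ`, `a d - b c > 0`, as conformal automorphisms of the
open upper half-plane `ℍₒ` in the sense of the tree's `ConformalEquiv` (Ahlfors, *Complex
Analysis* (1979), Ch. 3 §3: linear transformations; `Im (a z + b)/(c z + d) =
(a d - b c) Im z / |c z + d|²`). Everything here is PROVED and no definition is introduced: the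
automorphism is produced by the existence statement `exists_moebius_conformalEquiv` recording the
values of the map and of its inverse `w ↦ (d w - b)/(-c w + a)`. Further:

* `moebius_tendsto_ofReal` — boundary behaviour: at a real point `t` off the pole the map is
  continuous with the real value `(a t + b)/(c t + d)` and maps `ℍₒ` to `ℍₒ`, so it tends to
  that value within `ℍₒ` (the form in which boundary values of composites are computed);
* `moebius_real_sub`, `moebius_real_symm_den`, `moebius_real_leftInv`, `moebius_real_mem_uIcc` —
  the real trace: `M t - M s = (a d - b c)(t - s)/((c s + d)(c t + d))`, so `M` is increasing
  between two points on the same side of its pole and the closed interval between them stays on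
  that side.

The tree already has the special cases `ConformalEquiv.smulUpperHalfPlane` (dilations),
`addRealUpperHalfPlane` (real translations) and the normal form of all automorphisms of `ℍₒ`
(`ConformalEquiv.exists_eqOn_normalForm`, `HalfPlaneAutomorphism.lean`); the general real Möbius
map is what the matching of two marked quadruples (`MoebiusMatching.lean`) produces.

## References

* L. V. Ahlfors, *Complex Analysis*, 3rd ed. (1979), Ch. 3 §3. [AhlforsCA1979]
-/

noncomputable section

open Set Filter Topology Complex
open UpperHalfPlane (upperHalfPlaneSet isOpen_upperHalfPlaneSet)

namespace Literature.Probability.RandomPlanarGeometry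

section Moebius

variable {a b c d : ℝ}

/-- The denominator `c z + d` of a real Möbius map with `a d - b c > 0` does not vanish on the
open upper half-plane. [folklore] -/
theorem moebius_den_ne_zero (hdet : 0 < a * d - b * c) {z : ℂ} (hz : 0 < z.im) :
    (c : ℂ) * z + d ≠ 0 := by
  intro h
  have him : c * z.im = 0 := by
    have h' := congrArg Complex.im h
    simp only [add_im, mul_im, ofReal_re, ofReal_im, zero_mul, add_zero, zero_im] at h'
    exact h'
  have hre : c * z.re + d = 0 := by
    have h' := congrArg Complex.re h
    simp only [add_re, mul_re, ofReal_re, ofReal_im, zero_mul, sub_zero, zero_re] at h'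
    exact h'
  rcases mul_eq_zero.1 him with hc | hzi
  · subst hc
    rw [zero_mul, zero_add] at hre
    subst hre
    simp at hdet
  · exact absurd hzi hz.ne'

/-- Imaginary part of a real Möbius map: `Im (a z + b)/(c z + d) = (a d - b c) · Im z / |c z + d|²`. [folklore] -/
theorem moebius_im (z : ℂ) :
    (((a : ℂ) * z + b) / ((c : ℂ) * z + d)).im =
      (a * d - b * c) * z.im / Complex.normSq ((c : ℂ) * z + d) := by
  have h1 : ((a : ℂ) * z + b).im = a * z.im := by simp
  have h2 : ((a : ℂ) * z + b).re = a * z.re + b := by simp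
  have h3 : ((c : ℂ) * z + d).re = c * z.re + d := by simp
  have h4 : ((c : ℂ) * z + d).im = c * z.im := by simp
  rw [Complex.div_im, h1, h2, h3, h4]
  ring

/-- A real Möbius map with positive determinant maps `ℍₒ` into `ℍₒ`. [folklore] -/
theorem moebius_mapsTo (hdet : 0 < a * d - b * c) :
    MapsTo (fun z : ℂ => ((a : ℂ) * z + b) / ((c : ℂ) * z + d)) upperHalfPlaneSet
      upperHalfPlaneSet := by
  intro z hz
  have hz' : 0 < z.im := hz
  show 0 < (((a : ℂ) * z + b) / ((c : ℂ) * z + d)).im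
  rw [moebius_im]
  exact div_pos (mul_pos hdet hz') (Complex.normSq_pos.2 (moebius_den_ne_zero hdet hz'))

/-- The inverse Möbius map `(d w - b)/(-c w + a)` undoes `(a z + b)/(c z + d)` off the pole. [folklore] -/
theorem moebius_leftInv (hdet : a * d - b * c ≠ 0) {z : ℂ} (hz : (c : ℂ) * z + d ≠ 0) :
    ((d : ℂ) * (((a : ℂ) * z + b) / ((c : ℂ) * z + d)) + ((-b : ℝ) : ℂ)) /
        (((-c : ℝ) : ℂ) * (((a : ℂ) * z + b) / ((c : ℂ) * z + d)) + a) = z := by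
  have hdet' : (a : ℂ) * d - b * c ≠ 0 := by exact_mod_cast hdet
  have hden : ((-c : ℝ) : ℂ) * (((a : ℂ) * z + b) / ((c : ℂ) * z + d)) + a =
      ((a : ℂ) * d - b * c) / ((c : ℂ) * z + d) := by
    push_cast
    rw [mul_div_assoc', div_add' _ _ _ hz]
    congr 1
    ring
  have hnum : (d : ℂ) * (((a : ℂ) * z + b) / ((c : ℂ) * z + d)) + ((-b : ℝ) : ℂ) =
      ((a : ℂ) * d - b * c) * z / ((c : ℂ) * z + d) := by
    push_cast
    rw [mul_div_assoc', div_add' _ _ _ hz]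
    congr 1
    ring
  rw [hden, hnum, div_div_div_cancel_right₀ hz, mul_div_cancel_left₀ z hdet']

/-- A real Möbius map with positive determinant is holomorphic on `ℍₒ`. [folklore] -/
theorem moebius_differentiableOn (hdet : 0 < a * d - b * c) :
    DifferentiableOn ℂ (fun z : ℂ => ((a : ℂ) * z + b) / ((c : ℂ) * z + d))
      upperHalfPlaneSet :=
  (((differentiableOn_const _).mul differentiableOn_id).add_const _).div
    (((differentiableOn_const _).mul differentiableOn_id).add_const _)
    fun _ hz => moebius_den_ne_zero hdet hz

/-- **Real Möbius maps with positive determinant are conformal automorphisms of `ℍₒ`**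
(Ahlfors (1979), Ch. 3 §3): `z ↦ (a z + b)/(c z + d)` with inverse `w ↦ (d w - b)/(-c w + a)`
(`Im` of the value is `(a d - b c) Im z / |c z + d|² > 0`). [cite: AhlforsCA1979, Ch. 3 §3] -/
theorem exists_moebius_conformalEquiv (hdet : 0 < a * d - b * c) :
    ∃ M : ConformalEquiv upperHalfPlaneSet upperHalfPlaneSet,
      (∀ z, M z = ((a : ℂ) * z + b) / ((c : ℂ) * z + d)) ∧
      (∀ z, M.symm z = ((d : ℂ) * z + ((-b : ℝ) : ℂ)) / (((-c : ℝ) : ℂ) * z + a)) := by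
  have hdet' : 0 < d * a - (-b) * (-c) := by linarith
  refine ⟨{ toFun := fun z => ((a : ℂ) * z + b) / ((c : ℂ) * z + d)
            invFun := fun z => ((d : ℂ) * z + ((-b : ℝ) : ℂ)) / (((-c : ℝ) : ℂ) * z + a)
            source := upperHalfPlaneSet
            target := upperHalfPlaneSet
            map_source' := fun z hz => moebius_mapsTo hdet hz
            map_target' := fun z hz => moebius_mapsTo hdet' hz
            left_inv' := fun z hz => moebius_leftInv hdet.ne' (moebius_den_ne_zero hdet hz)
            right_inv' := fun z hz => ?_
            source_eq := rfl
            target_eq := rfl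
            differentiableOn := moebius_differentiableOn hdet
            differentiableOn_symm := moebius_differentiableOn hdet' }, fun z => rfl, fun z => rfl⟩
  -- right inverse: the same identity for the inverse coefficients `(d, -b, -c, a)`
  have h := moebius_leftInv (a := d) (b := -b) (c := -c) (d := a) hdet'.ne'
    (moebius_den_ne_zero hdet' hz)
  simpa using h

/-- **Boundary behaviour of a real Möbius map**: at a real point `t` off the pole it is
continuous with the real value `(a t + b)/(c t + d)`, and maps `ℍₒ` to `ℍₒ`, hence tends to that
value within `ℍₒ` as `z → t` within `ℍₒ`. [folklore] -/
theorem moebius_tendsto_ofReal (hdet : 0 < a * d - b * c) {t : ℝ} (ht : c * t + d ≠ 0) :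
    Tendsto (fun z : ℂ => ((a : ℂ) * z + b) / ((c : ℂ) * z + d)) (𝓝[upperHalfPlaneSet] (t : ℂ))
      (𝓝[upperHalfPlaneSet] (((a * t + b) / (c * t + d) : ℝ) : ℂ)) := by
  have hden : (c : ℂ) * t + d ≠ 0 := by exact_mod_cast ht
  have hcont : ContinuousAt (fun z : ℂ => ((a : ℂ) * z + b) / ((c : ℂ) * z + d)) (t : ℂ) :=
    ((continuous_const.mul continuous_id).add continuous_const).continuousAt.div
      ((continuous_const.mul continuous_id).add continuous_const).continuousAt hden
  have hval : (((a * t + b) / (c * t + d) : ℝ) : ℂ) = ((a : ℂ) * t + b) / ((c : ℂ) * t + d) := by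
    push_cast
    ring
  rw [hval]
  exact hcont.continuousWithinAt.tendsto_nhdsWithin (moebius_mapsTo hdet)

/-! ### The real trace of a Möbius map -/

/-- Difference of two real values of a Möbius map off the pole:
`M t - M s = (a d - b c)(t - s)/((c s + d)(c t + d))`. [folklore] -/
theorem moebius_real_sub {s t : ℝ} (hs : c * s + d ≠ 0) (ht : c * t + d ≠ 0) :
    (a * t + b) / (c * t + d) - (a * s + b) / (c * s + d) =
      (a * d - b * c) * (t - s) / ((c * s + d) * (c * t + d)) := by
  rw [div_sub_div _ _ ht hs, div_eq_div_iff (mul_ne_zero ht hs) (mul_ne_zero hs ht)]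
  ring

/-- At an image point the denominator of the inverse map is `(a d - b c)/(c t + d)`. [folklore] -/
theorem moebius_real_symm_den {t : ℝ} (ht : c * t + d ≠ 0) :
    -c * ((a * t + b) / (c * t + d)) + a = (a * d - b * c) / (c * t + d) := by
  rw [mul_div_assoc', div_add' _ _ _ ht]
  congr 1
  ring

/-- The inverse Möbius map undoes the map at real points off the pole. [folklore] -/
theorem moebius_real_leftInv (hdet : a * d - b * c ≠ 0) {t : ℝ} (ht : c * t + d ≠ 0) :
    (d * ((a * t + b) / (c * t + d)) + -b) / (-c * ((a * t + b) / (c * t + d)) + a) = t := by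
  rw [moebius_real_symm_den ht]
  have hnum : d * ((a * t + b) / (c * t + d)) + -b = (a * d - b * c) * t / (c * t + d) := by
    rw [mul_div_assoc', div_add' _ _ _ ht]
    congr 1
    ring
  rw [hnum, div_div_div_cancel_right₀ ht, mul_div_cancel_left₀ t hdet]

/-- **A real Möbius map with positive determinant is increasing between two points on the same
side of its pole**, and the whole closed interval between them stays on that side: for
`t ∈ [s₀, s₁]` (unordered) with `(c s₀ + d)(c s₁ + d) > 0`, also `(c s₀ + d)(c t + d) > 0` and
`M t` lies between `M s₀` and `M s₁`. [folklore] -/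
theorem moebius_real_mem_uIcc (hdet : 0 < a * d - b * c) {s₀ s₁ t : ℝ}
    (hsign : 0 < (c * s₀ + d) * (c * s₁ + d)) (ht : t ∈ uIcc s₀ s₁) :
    0 < (c * s₀ + d) * (c * t + d) ∧
      (a * t + b) / (c * t + d) ∈
        uIcc ((a * s₀ + b) / (c * s₀ + d)) ((a * s₁ + b) / (c * s₁ + d)) := by
  -- the affine denominator keeps its sign between two points where it has the same sign
  have key : ∀ {p q r : ℝ}, p ≤ r → r ≤ q → 0 < (c * p + d) * (c * q + d) →
      0 < (c * p + d) * (c * r + d) ∧ 0 < (c * r + d) * (c * q + d) := by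
    intro p q r hpr hrq hpq
    rcases mul_pos_iff.1 hpq with ⟨hp, hq⟩ | ⟨hp, hq⟩
    · have hr : 0 < c * r + d := by
        rcases le_or_gt 0 c with hc | hc
        · nlinarith
        · nlinarith
      exact ⟨mul_pos hp hr, mul_pos hr hq⟩
    · have hr : c * r + d < 0 := by
        rcases le_or_gt 0 c with hc | hc
        · nlinarith
        · nlinarith
      exact ⟨mul_pos_of_neg_of_neg hp hr, mul_pos_of_neg_of_neg hr hq⟩
  -- monotonicity between two points on the same side of the pole
  have mono : ∀ {p q : ℝ}, p ≤ q → 0 < (c * p + d) * (c * q + d) →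
      (a * p + b) / (c * p + d) ≤ (a * q + b) / (c * q + d) := by
    intro p q hpq hsgn
    have hp : c * p + d ≠ 0 := left_ne_zero_of_mul hsgn.ne'
    have hq : c * q + d ≠ 0 := right_ne_zero_of_mul hsgn.ne'
    rw [← sub_nonneg, moebius_real_sub hp hq]
    exact div_nonneg (mul_nonneg hdet.le (sub_nonneg.2 hpq)) hsgn.le
  rcases le_total s₀ s₁ with h01 | h10
  · rw [uIcc_of_le h01] at ht
    obtain ⟨h1, h2⟩ := key ht.1 ht.2 hsign
    exact ⟨h1, Icc_subset_uIcc ⟨mono ht.1 h1, mono ht.2 h2⟩⟩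
  · rw [uIcc_of_ge h10] at ht
    have hsign' : 0 < (c * s₁ + d) * (c * s₀ + d) := by rwa [mul_comm]
    obtain ⟨h1, h2⟩ := key ht.1 ht.2 hsign'
    refine ⟨by rwa [mul_comm] at h2, Icc_subset_uIcc' ⟨mono ht.1 h1, mono ht.2 h2⟩⟩

end Moebius

end Literature.Probability.RandomPlanarGeometry

end
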